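import Summits.AtomisticToContinuum.Crystallization.Theorems.ThreeConeCertificateSlackRigidityPricedFloorsDefs
import Summits.AtomisticToContinuum.Crystallization.Theorems.PalmUnimodularRigidityMinimiserShellsEnergyFloorC
import HarnessLib

/-!
# `SlackRigidity` (stmt-AtomisticToContinuum-11960), line `priced-floors-palm-exactification`, stub S3
# (`stub_layeredMeanSelection`): the abstract transport identity (layer stationarity, measure part)

Lead c19, S3 probabilistic core, part 1.  The Mecke identity (`IsPointStationaryLaw`) turned into a
MASS-TRANSPORT IDENTITY for a pair of weight kernels: if `Ωr μ y` ("mass RECEIVED by the root from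
its point `y`") is jointly measurable, has total mass `1` at almost every sample (BALANCE), and seen
from `y` is the mass SENT by the root to `y`, `Ωr (θ_y μ) (−y) = Ωs μ y` (COVARIANCE), then for every
measurable `G ≥ 0`

  `∫ G dP = ∫ (Σ_{y ∈ μ} Ωs μ y · G(θ_y μ)) dP(μ)`                      (`lintegral_eq_transport`)

— the law of the sample seen from the root equals the `Ωs`-weighted law of the sample seen from the
points the root sends mass to.  With the canonical layer transport of the line (`transportWeight`:
half the mass to each of the two layers at layer-distance `k`, split among the nearest points) this is
LAYER STATIONARITY.  Only `g(μ, y) = Ωr μ y · G μ` is fed to the Mecke identity, so no measurability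
of the re-rooting map is needed.  Registered sub-goal `lms_lintegral_eq_transport`.  All `[folklore]`.
-/

noncomputable section

open MeasureTheory Filter Set
open scoped ENNReal BigOperators Topology

namespace Summit.AtomisticToContinuum.Crystallization.Theorems.SlackRigidityPricedFloorsStationarity

open Literature.Probability.Process
open Summit.AtomisticToContinuum.Crystallization.Theorems.SlackRigidityPricedFloors
open Summit.AtomisticToContinuum.Crystallization.Theorems.PalmUnimodularRigidityMinimiserShells.EnergyFloor
  (lintegral_count_restrict_eq_tsum)
open Summit.AtomisticToContinuum.Crystallization.Theorems.MinimiserShells.Negative.Rootedness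
  (countable_of_separated)

/-- On a counting measure `count|S` (`S` countable), two functions that agree on `S` have the same
`lintegral`. [folklore] -/
theorem lintegral_count_restrict_congr {S : Set E3} (hS : S.Countable) {f g : E3 → ℝ≥0∞}
    (h : ∀ y ∈ S, f y = g y) :
    ∫⁻ y, f y ∂((Measure.count : Measure E3).restrict S) =
      ∫⁻ y, g y ∂((Measure.count : Measure E3).restrict S) := by
  rw [lintegral_count_restrict_eq_tsum hS, lintegral_count_restrict_eq_tsum hS]
  exact tsum_congr fun y => h y y.2

/-- **The transport identity** (registered sub-goal `lms_lintegral_eq_transport`).  For a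
point-stationary law `P` a.s. carried by rooted `δ`-hard-core configurations, a jointly measurable
RECEIVED-weight kernel `Ωr` of total mass `1` at a.e. sample whose re-rooted values are the SENT
weights `Ωs`, and every measurable `G ≥ 0`: `∫ G dP = ∫ (∫ Ωs μ y · G(θ_y μ) dμ(y)) dP(μ)`. [folklore] -/
theorem lms_lintegral_eq_transport : ∀ (δ : ℝ), 0 < δ → ∀ (P : Measure (Measure E3)), IsPointStationaryLaw P → (∀ᵐ μ ∂P, IsRootedHardCore δ μ) → ∀ (Ωr Ωs : Measure E3 → E3 → ℝ≥0∞), Measurable (Function.uncurry Ωr) → (∀ᵐ μ ∂P, ∫⁻ y, Ωr μ y ∂μ = 1) → (∀ᵐ μ ∂P, ∀ y : E3, μ {y} ≠ 0 → Ωr (μ.map (fun z => z - y)) (-y) = Ωs μ y) → ∀ (G : Measure E3 → ℝ≥0∞), Measurable G → ∫⁻ μ, G μ ∂P = ∫⁻ μ, ∫⁻ y, Ωs μ y * G (μ.map (fun z => z - y)) ∂μ ∂P := by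
  intro δ hδ P hstat hcore Ωr Ωs hΩr hbal hcov G hG
  -- Mecke with `g(μ, y) = Ωr μ y · G μ`
  set g : Measure E3 → E3 → ℝ≥0∞ := fun μ y => Ωr μ y * G μ with hg
  have hgm : Measurable (Function.uncurry g) := hΩr.mul (hG.comp measurable_fst)
  have hM := hstat g hgm
  -- LHS of Mecke: the mass received is `1`, so it is `∫ G`
  have hL : ∫⁻ μ, ∫⁻ y, g μ y ∂μ ∂P = ∫⁻ μ, G μ ∂P := by
    refine lintegral_congr_ae ?_
    filter_upwards [hbal] with μ hμ
    have hsec : Measurable fun y => Ωr μ y := hΩr.comp measurable_prodMk_left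
    simp only [hg]
    rw [lintegral_mul_const _ hsec, hμ, one_mul]
  -- RHS of Mecke: by covariance the integrand is `Ωs μ y · G(θ_y μ)` at the atoms
  have hR : ∫⁻ μ, ∫⁻ y, g (μ.map (fun z => z - y)) (-y) ∂μ ∂P =
      ∫⁻ μ, ∫⁻ y, Ωs μ y * G (μ.map (fun z => z - y)) ∂μ ∂P := by
    refine lintegral_congr_ae ?_
    filter_upwards [hcore, hcov] with μ hc hcv
    obtain ⟨S, -, hsep, rfl⟩ := hc
    refine lintegral_count_restrict_congr (countable_of_separated hδ hsep) fun y hy => ?_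
    simp only [hg]
    rw [hcv y ((count_restrict_singleton_ne_zero_iff S y).2 hy)]
  rw [← hL, hM, hR]

end Summit.AtomisticToContinuum.Crystallization.Theorems.SlackRigidityPricedFloorsStationarity

end
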